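import Summits.BirchSwinnertonDyer.Rank1Residual.ManinAdditive.NeronConwayR
import Literature.NumberTheory.EllipticCurves.Newforms
import Literature.NumberTheory.EllipticCurves.NewformsLevelRaising
import HarnessLib
import HarnessLib.Audit.Tags

/-!
# LEVEL-LOWERING LAWS for the Conway lattice at `2`: E-imc-139 `HalfConwayLevelLowering`, E-imc-139♯
# `HalfConwayTracePowerOfTwo`, E-imc-140 (★) `LevelConwayIsHalfConwayBelow` — cell `bsd-f2-manin` (D-0131 (3) frontier:
# the Manin constant at additive primes), lens imc (Conway / End / degeneracy-saturated lattices at `2`), planner imc g18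
# MEMO-imc §24 (24.17)–(24.21); typed by the cell typer g14 (T-imc-22, 2026-08-28T17:39:27Z) VERBATIM from
# HOME/imc/Sketch-imc-g18e.lean sha16 fe5b4563ed8bcd5b (farm rc 0 · 0 sorries), docstrings extended with the honest framing.

HONEST FRAMING.  All three rows are E-BLIND LATTICE LAWS about `S^G(N) = conwayStableLattice N` (`ConwayCut.lean`) and the
tree's inter-level maps `adjDegeneracyMap0 N M 1 2 = Tr^N_M = [Γ₀(N)·1·Γ₀(M)]` [DiamondShurman2005, §5.1 (3)] /
[Li1975, §2 Lemma 5] and `toLevel0 (h : M ∣ N) 2 : S₂(Γ₀(M)) ↪ S₂(Γ₀(N))` (`NewformsLevelRaising.lean`, same function on `ℍ`);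
nothing is asserted (`@[conjecture]`), each is decidable level by level by exact linear algebra on `q`-expansions, and NONE
is in print (nearest print: the Néron mapping property / Pic–Alb functoriality of the degeneracy maps [BLRNeronModels1990,
§7.1], which gives the INTEGRAL cuts `U₂Λ(N), Tr Λ(N) ⊆ Λ(N/2)` of row E-imc-138 — a FACT about the Néron lattice `Λ`, not about
`S^G`).  BC5 witness (ENGINE 6 v13–v16, kit j313397 / j313527 / j313775 / j313839 / j314136, tables
HOME/imc/kit-g18/g18-neronconway-{U2TEST-v13 271de332908de5e3, U4TEST-v14 2f88ca779fe464f9, STARTEST-v15 cbbcf28d985887e6,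
IDTEST-v15c 435c2cfb677944dd, U8TEST-v16 beeb1e60e65571b8}, all evidence on stmt-BirchSwinnertonDyer-22967): E-139♯ holds for
`N/M ∈ {2, 4, 8}` at 54/54 · 29/29 · 12/12 informative levels (`8 ∣ N ≤ 400` + `N = 1152`; `16 ∣ N ≤ 528`; `32 ∣ N ≤ 512`), ONE
factor `2`, never accumulating; E-140 (★) at 55 levels, 0 exceptions; the identity `Tr^N_{N/2} = w_{N/2} ∘ U₂ ∘ w_N` (`4 ∣ N`,
`k = 2`) numerically 1200/1200 basis vectors at 46 levels and PINNED by refuter-1 (§R74: 4-line proof, hand check on `S₂(44)`).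
REF1: §R74 (R-imc-52/53, 2026-08-28T17:19:33Z) — «type E-139 once, Tr-form» (n2), L1–L3 / PROP A / PROP B / PROP C PASS,
`E-139 ⟹ E-134` (exponent law, `NeronConwayD.ConwayRamanujanExponentLaw`) as a paper theorem; R-imc-54 (audit of identity (a)
and an attack on (★) via eta/Eisenstein expansions or Katz–Mazur at the cusp `1/(M/2)`) PENDING at filing.  Why novel: the
exponent phenomenon `e(R₄ | S^G) ≤ 1` at `2` (E-imc-134) is reduced to ONE single-level cusp statement (★).  Reading for the
Manin question: these laws constrain the certifiable E-blind lattices from BELOW only (MEMO-imc §24: no upper bound on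
`ord₂ c_E` comes from this side).  PARTITION ladder-live (C2 stmt-BirchSwinnertonDyer-22967) · beyond-print theorem: no ·
BSD is not proved by this; Manin `c = 1` is not proved by this.

imc g18 VERBATIM:

Typed against the tree's inter-level maps (pointer -ty 2026-08-28T17:19Z / 17:37Z):
`adjDegeneracyMap0 N M 1 2 = Tr^N_M = [Γ₀(N) · 1 · Γ₀(M)]` (Diamond–Shurman §5.1 (3)) and
`toLevel0 (h : M ∣ N) 2 : S₂(Γ₀(M)) ↪ S₂(Γ₀(N))` (same function on ℍ).

* E-imc-139 `HalfConwayLevelLowering` (Tr-form, REF1 §R74 n2): `8 ∣ N ⟹ Tr^N_{N/2} S^G(N) ⊆ ½·S^G(N/2)`.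
  ENGINE 6 v13/v15: 46/46 levels `8 ∣ N ≤ 400` (+ N = 1152), via the paper identity
  `Tr^N_{N/2} = w_{N/2} ∘ U₂ ∘ w_N` (MEMO (24.19)(a); IDTEST 1200/1200).
* E-imc-139♯ `HalfConwayTracePowerOfTwo`: `4 ∣ M`, `N = M·2^j` ⟹ `Tr^N_M S^G(N) ⊆ ½·S^G(M)` — ONE factor 2,
  never accumulating (j = 1: 46/46; j = 2: 29/29 levels `16 ∣ N ≤ 528` via `U₄ = w_{N/4} Tr^N_{N/4} w_N`,
  REF1 §R74 add.-1; j ≥ 3 is extrapolation, untested).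
* E-imc-140 `LevelConwayIsHalfConwayBelow` (★): `8 ∣ N`, `g ∈ S₂(Γ₀(N/2))` Conway-integral AT LEVEL N ⟹ `2g ∈ S^G(N/2)`
  (46/46 levels `8 ∣ N ≤ 400`, + N = 1152).  (★) + identity ⟹ E-139 ⟹ E-134 (`NeronConwayD`).
All three are E-blind and decidable level by level.  BSD / Manin c = 1 are not proved by any of this.

v2 APPEND (imc g18 Sketch-imc-g18e.lean v2 sha16 49af2facdf07c23e, MEMO-imc §24 (24.22), T-imc-22 v2 2026-08-28T17:54:26Z;
typer g14): the single-level form — defs `conwayStableLatticeAtTwo` (`S^{⟨w₂,t⟩}(N)`), `threeCuspLattice` (`S₃(N)`), laws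
E-imc-141 `ThreeCuspHalfConwaySharp` / E-imc-141♭ `ThreeCuspHalfConway` (★★) «integral at `∞`, half-integral at `0` and `½`
⟹ `2x ∈ S^{⟨w₂,t⟩}(N)`» (57/57 levels `8 ∣ N ≤ 528`, ENGINE 6 v17), edges `conwayStableLattice_le_atTwo`,
`threeCuspHalfConway_of_sharp`.  Chain E-141 ⟹ E-140 ⟹ E-139 ⟹ E-134, seams paper-level.

v3 APPEND (imc g18 Sketch-imc-g18f.lean v2 sha16 542089a401ca956c, MEMO-imc §24 (24.23)–(24.24), T-imc-23 v2 2026-08-28T18:18:21Z;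
typer g14): the KM–Edixhoven LP predictions — E-imc-142 `TwoAdjacentCuspsHalfConway` (integral at `∞` and `½` ⟹ `2x ∈ S^{⟨w₂,t⟩}`;
84/84, non-vacuous 73), edge `threeCuspHalfConway_of_twoAdjacent` (E-142 ⟹ E-141♭), E-imc-143 `EightIntegralAtHalfLevelCusp`
(`8x` integral at `1/(N/2)`; attained at `v = 2, 3`).  imc's file name `NeronConwayCusp.lean` / namespace `NeronConwayCusp` is
NOT used: the shared decls were already landed here (p654814), so the family stays in ONE file and ONE namespace.
-/

noncomputable section

open scoped MatrixGroups ModularForm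
open CongruenceSubgroup Literature.NumberTheory.EllipticCurves.ModularForms
open Summit.BirchSwinnertonDyer.Rank1Residual.ManinAdditive
open Summit.BirchSwinnertonDyer.Rank1Residual.ManinAdditive.ConwayCut

namespace Summit.BirchSwinnertonDyer.Rank1Residual.ManinAdditive.NeronConwayLevel

/-- LAW E-imc-139♯ (imc g18; conjecture, E-blind): for `4 ∣ M` and `N = M · 2^j`, the trace
`Tr^N_M = adjDegeneracyMap0 N M 1 2` maps the Conway lattice of level `N` into HALF the Conway lattice of
level `M`.  Evidence: j = 1 at 46/46 levels `8 ∣ N ≤ 400`, j = 2 at 29/29 levels `16 ∣ N ≤ 528`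
(ENGINE 6 v13–v15, HOME/imc/kit-g18/); j ≥ 3 untested.  Why it might fail: j ≥ 3; a level beyond the tested range.
TYPER FRAMING (imc 2026-08-28T17:43:42Z update, MEMO-imc §24 (24.21), U8TEST-v16 beeb1e60e65571b8, kit j314136): j = 3 is now
TESTED — `U₈S^G(N) ⊆ ½S^G(N/8)` at 12/12 informative levels `32 ∣ N ≤ 512`; so the law holds for `N/M ∈ {2, 4, 8}` at
54/54 · 29/29 · 12/12, one factor `2` never accumulating; `j ≥ 4` untested.  NOT in print.  REF1 §R74 add.-1 suggested exactly
this single law «`Tr^N_M S^G(N) ⊆ ½S^G(M)`, `4 ∣ M ∣ N`»; R-imc-54 PENDING.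
[cite: DiamondShurman2005, §5.1 (3) (shape only: the trace map `Tr^N_M` as a double coset; the half-Conway trace law is the cell's E-imc-139♯, NOT in print — imc MEMO-imc §24 (24.18)–(24.21))] -/
@[conjecture] def HalfConwayTracePowerOfTwo : Prop :=
  ∀ (N M : ℕ) [NeZero N] [NeZero M], 4 ∣ M → (∃ j : ℕ, N = M * 2 ^ j) →
    ∀ x ∈ conwayStableLattice N, (2 : ℂ) • adjDegeneracyMap0 N M 1 2 x ∈ conwayStableLattice M

/-- LAW E-imc-139 (imc g18; conjecture, E-blind; the j = 1 case, stated once in Tr-form as REF1 §R74 n2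
recommends): `8 ∣ N ⟹ 2 · Tr^N_{N/2}(S^G(N)) ⊆ S^G(N/2)`.  46/46 levels `8 ∣ N ≤ 400` and N = 1152.
TYPER FRAMING: the `U₂`-form «`U₂S^G(N) ⊆ ½S^G(N/2)`» and the equal-index clause «`U₂`-cut = `Tr`-cut = `R₄`-defect `K(N)`
(`NeronConwayD.ramanujanFourPreimage`), 31/31 levels `16 ∣ N ≤ 528`» of the CANDIDATES row follow from this Tr-form by the
identity `Tr^N_{N/2} = w_{N/2} ∘ U₂ ∘ w_N` (refuter-1 §R74, pinned; `U₂ = adjDegeneracyMap0 N (N/2) 2 2` modulo the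
`det^{k−1}` normalisation of REF1 A80.2) and are not typed separately (REF1 n2).  PAPER THEOREM (MEMO-imc §24 (24.17)(a), REF1
§R74 PASS): E-139 ⟹ E-imc-134 `NeronConwayD.ConwayRamanujanExponentLaw` via L1 «`S^G(N/2) + 2V₂S^G(N/2) ⊆ S^G(N)`» and L2
«`R₄ = 2V₂tU₂`» — not formalised here (the operators `V₂`, `w` on `S^G` and the identity are not in the tree).  NOT in print.
Binder note: `[NeZero (N / 2)]` is a hypothesis of the law (at `8 ∣ N` it is automatic: `N / 2 ≥ 4`); consumers supply
`⟨(Nat.div_pos … ).ne'⟩`-style instances or `haveI`.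
[cite: Li1975, §2 Lemma 5 (shape only: `Tr^N_M` / its adjointness to the degeneracy map; the half-Conway level-lowering law is the cell's E-imc-139, NOT in print — imc MEMO-imc §24 (24.17))] -/
@[conjecture] def HalfConwayLevelLowering : Prop :=
  ∀ (N : ℕ) [NeZero N] [NeZero (N / 2)], 8 ∣ N →
    ∀ x ∈ conwayStableLattice N, (2 : ℂ) • adjDegeneracyMap0 N (N / 2) 1 2 x ∈ conwayStableLattice (N / 2)

/-- LAW E-imc-140 (★) (imc g18; conjecture, E-blind, single-level cusp statement): for `8 ∣ N`, a cusp form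
`g` of level `N/2` whose image in level `N` is Conway-integral (i.e. `g` integral at `∞` and HALF-integral at
the cusps `0` and `1/2` of `X₀(N/2)`) satisfies `2g ∈ S^G(N/2)` (half-integral on the whole Conway orbit).
46/46 levels `8 ∣ N ≤ 400` and N = 1152 (ENGINE 6 v15 STARTEST).  With the identity
`Tr^N_{N/2} = w_{N/2} ∘ U₂ ∘ w_N` it implies `HalfConwayLevelLowering`.  Why it might fail: a level > 400.
TYPER FRAMING (imc 17:43:42Z update): (★) at 55 levels, 0 exceptions (STARTEST-v15 cbbcf28d985887e6 + U8TEST-v16).  The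
implication (★) + identity ⟹ E-139 is a PAPER step (MEMO-imc §24 (24.19); proof of (★) itself OPEN: «AL algebra is circular,
needs the arithmetic of the cusp `1/(M/2)`», imc) — not formalised here.  `toLevel0 hd 2 g` is the SAME function as `g` on
`ℍ` (`coe_toLevel0`, rfl), so «Conway-integral AT LEVEL `N`» is literally membership of `g`'s level-`N` avatar in `S^G(N)`.
NOT in print (nearest: Katz–Mazur `q`-expansion principle at the cusps of `X₀(N) ⊗ 𝔽₂` — shape only).  REF1 R-imc-54 PENDING.
[cite: DiamondShurman2005, §5.1 (3) (shape only: level-raising inclusion `S₂(Γ₀(M)) ⊂ S₂(Γ₀(N))`; the single-level half-Conway cusp law (★) is the cell's E-imc-140, NOT in print — imc MEMO-imc §24 (24.19))] -/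
@[conjecture] def LevelConwayIsHalfConwayBelow : Prop :=
  ∀ (N : ℕ) [NeZero N] [NeZero (N / 2)] (h8 : 8 ∣ N) (hd : N / 2 ∣ N),
    ∀ g : CuspForm (Gamma0 (N / 2)) 2,
      toLevel0 hd 2 g ∈ conwayStableLattice N → (2 : ℂ) • g ∈ conwayStableLattice (N / 2)

/-- Edge (imc g18 VERBATIM, PROVED): the power-of-two trace law specialises to the level-halving law (j = 1). -/
theorem halfConwayLevelLowering_of_tracePowerOfTwo (h : HalfConwayTracePowerOfTwo) :
    HalfConwayLevelLowering := by
  intro N _ _ h8 x hx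
  have h2 : 2 ∣ N := dvd_trans ⟨4, by norm_num⟩ h8
  have h4 : 4 ∣ N / 2 := by
    obtain ⟨m, hm⟩ := h8
    refine ⟨m, ?_⟩
    subst hm
    omega
  refine h N (N / 2) h4 ⟨1, ?_⟩ x hx
  have := Nat.div_mul_cancel h2
  omega

/-! ## Single-level form: the three-cusp lattice (MEMO-imc §24 (24.22), ENGINE 6 v17 CUSP3) -/

/-- The **2-primary Conway lattice** `S^{⟨w₂,t⟩}(N)`: largest `ℤ`-submodule of the integral cusp forms stable
under the 2-primary Atkin–Lehner involution `w_{2^{v₂(N)}}` and the half-translation `t` (no odd `w_q`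
condition; 2-adically this is all that matters for the laws below).  `conwayStableLattice N ≤` it for `2 ∣ N`. -/
def conwayStableLatticeAtTwo (N : ℕ) [NeZero N] : Submodule ℤ (CuspForm (Gamma0 N) 2) :=
  sSup {M | M ≤ integralCuspForms0 N 2 ∧
    M.map ((atkinLehnerInvolutionAt N 2 2).restrictScalars ℤ) ≤ M ∧
    M.map ((halfTranslate N 2).restrictScalars ℤ) ≤ M}

/-- `S^G(N) ≤ S^{⟨w₂,t⟩}(N)` for `2 ∣ N` (dropping the odd `w_q`-conditions only enlarges the largest stable lattice).
(imc g18 v2 VERBATIM, PROVED.) -/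
theorem conwayStableLattice_le_atTwo (N : ℕ) [NeZero N] (h2 : 2 ∣ N) :
    conwayStableLattice N ≤ conwayStableLatticeAtTwo N := by
  refine sSup_le_sSup ?_
  intro M hM
  exact ⟨hM.1, hM.2.1 2 Nat.prime_two h2, hM.2.2⟩

/-- The **three-cusp lattice** `S₃(N)`: integral cusp forms `x` (cusp `∞`) with `w x` integral (cusp `0`) and
`w (t x)` integral (cusp `½`), `w = w_{2^{v₂(N)}}`; i.e. `kmCuspLattice` without its fourth condition
(cusp `w(½) = 1/(N/2)`), written with preimages. -/
def threeCuspLattice (N : ℕ) [NeZero N] : Submodule ℤ (CuspForm (Gamma0 N) 2) :=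
  let S := integralCuspForms0 N 2
  let w := (atkinLehnerInvolutionAt N 2 2).restrictScalars ℤ
  let t := (halfTranslate N 2).restrictScalars ℤ
  S ⊓ S.comap w ⊓ S.comap (w ∘ₗ t)

/-- LAW E-imc-141 (imc g18; conjecture, E-blind, single level; the sharp «half» form): for `8 ∣ N`, an
integral cusp form that is HALF-integral at the cusps `0` and `½` (`2·w x`, `2·w(t x)` integral) satisfies
`2x ∈ S^{⟨w₂,t⟩}(N)` — half-integral on the whole Conway orbit, in particular at the fourth reduced-component
cusp `1/(N/2)`.  ENGINE 6 v17 (kit j314228): 56/56 levels `8 ∣ N ≤ 464…528`, 0 exceptions; implies E-140 (★)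
(a level-`N/2` form Conway-integral at level `N` is exactly: integral at `∞`, half-integral at `0`, `½`) and hence,
with `Tr^N_{N/2} = w_{N/2}∘U₂∘w_N`, E-139 and the exponent law E-134.  Why it might fail: a level beyond the
tested range; proof needs the arithmetic of the cusp `1/(N/2)` (CNS arXiv:1911.09446 Thm 1.5 gives it for
newforms only; for the lattice: Conrad, BDP17 App. B intersection theory on the regular model at 2).
TYPER FRAMING (appended by the cell typer g14, T-imc-22 v2, 2026-08-28T17:54:26Z; source HOME/imc/Sketch-imc-g18e.lean v2 sha16
49af2facdf07c23e VERBATIM, MEMO-imc §24 (24.22)): lens imc; E-BLIND single-level CUSP LAW, nothing asserted, decidable level by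
level.  BC5 witness: ENGINE 6 v17 CUSP3 (kit j314228, table HOME/imc/kit-g18/g18-neronconway-CUSP3-v17.txt 891589be50b8dcb2,
evidence on stmt-BirchSwinnertonDyer-22967): 57/57 levels `8 ∣ N ≤ 528`, 0 exceptions; NON-VACUOUS: `[S₃(N) : S^G(N)] = 2^{1…5}`
at 43/56 levels, always with exponent-`1` defect («the three-cusp Conway defect is 2-torsion»).  NOT in print: nearest print is
the `2`-integrality of NEWFORM `q`-expansions at the cusp `1/(N/2)` [CesnaviciusNeururerSaha2023, Thm. 1.5 (arXiv:1911.09446)]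
— a statement about newforms, not about the integral lattice; the chain E-141 ⟹ E-140 ⟹ E-139 ⟹ E-134 is paper-level (MEMO-imc
§24 (24.19)–(24.22); identity `Tr^N_{N/2} = w_{N/2}∘U₂∘w_N` audited PASS by refuter-1 §R74 / R-imc-54 (a) 17:44:51Z).  REF1
R-imc-55 (proof plan / statement audit of E-141) PENDING at filing.  Why novel: reduces the exponent phenomenon at `2` to the
arithmetic of ONE cusp.  Beyond-print theorem: no.  OPEN.
[cite: CesnaviciusNeururerSaha2023, Thm. 1.5 (shape only: 2-integrality of newforms at the cusp 1/(N/2); the three-cusp half-Conway LATTICE law is the cell's E-imc-141, NOT in print — imc MEMO-imc §24 (24.22))] -/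
@[conjecture] def ThreeCuspHalfConwaySharp : Prop :=
  ∀ (N : ℕ) [NeZero N], 8 ∣ N → ∀ x ∈ integralCuspForms0 N 2,
    (2 : ℂ) • atkinLehnerInvolutionAt N 2 2 x ∈ integralCuspForms0 N 2 →
    (2 : ℂ) • atkinLehnerInvolutionAt N 2 2 (halfTranslate N 2 x) ∈ integralCuspForms0 N 2 →
      (2 : ℂ) • x ∈ conwayStableLatticeAtTwo N

/-- LAW E-imc-141♭ (★★) (imc g18; conjecture): «the Conway defect of the three-cusp lattice is 2-torsion»:
`8 ∣ N ⟹ 2·S₃(N) ⊆ S^{⟨w₂,t⟩}(N)`.  ENGINE 6 v17: 56/56 levels (`[S₃ : S^G]` = `2^{0…5}`, odd part 1,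
nontrivial at 43/56).  Special case of `ThreeCuspHalfConwaySharp`.
TYPER FRAMING: as for `ThreeCuspHalfConwaySharp` (same source, same census: 57/57 levels `8 ∣ N ≤ 528` per imc 17:54:26Z; the
sketch text says 56/56 — one level was added in the INBOX line); `threeCuspLattice N` = `kmCuspLattice N` (`ConwayCut.lean`, the
Katz–Mazur cusp lattice at `2`) WITHOUT its fourth cusp condition, so E-141♭ reads «`2·S₃(N) ⊆ S^{⟨w₂,t⟩}(N)`».  REF1 R-imc-55
PENDING.  NOT in print.  OPEN.
[cite: CesnaviciusNeururerSaha2023, Thm. 1.5 (shape only; the lattice law E-imc-141♭ is the cell's, NOT in print — imc MEMO-imc §24 (24.22))] -/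
@[conjecture] def ThreeCuspHalfConway : Prop :=
  ∀ (N : ℕ) [NeZero N], 8 ∣ N → ∀ x ∈ threeCuspLattice N, (2 : ℂ) • x ∈ conwayStableLatticeAtTwo N

/-- Edge E-141 ⟹ E-141♭ (imc g18 v2 VERBATIM, PROVED): a three-cusp-integral form is in particular half-integral at `0` and
`½`. -/
theorem threeCuspHalfConway_of_sharp (h : ThreeCuspHalfConwaySharp) : ThreeCuspHalfConway := by
  intro N _ h8 x hx
  simp only [threeCuspLattice, Submodule.mem_inf, Submodule.mem_comap, LinearMap.coe_comp,
    Function.comp_apply, LinearMap.coe_restrictScalars] at hx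
  obtain ⟨⟨h0, h1⟩, h2⟩ := hx
  refine h N h8 x h0 ?_ ?_
  · rw [two_smul]; exact (integralCuspForms0 N 2).add_mem h1 h1
  · rw [two_smul]; exact (integralCuspForms0 N 2).add_mem h2 h2

/-! ## Predictions of the Katz–Mazur/Edixhoven intersection LP (MEMO-imc §24 (24.23); ENGINE 6 v20, kit j314702) -/

/-- LAW E-imc-142 `TwoAdjacentCuspsHalfConway` (imc g18; conjecture = exact value of the KM–Edixhoven LP for every
`v₂(N) = 3…12`): for `8 ∣ N`, an integral cusp form that is integral at the ADJACENT orbit cusp `½`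
(`w (t x)` integral) already satisfies `2x ∈ S^{⟨w₂,t⟩}(N)`.  Implies E-141♭.  ENGINE 6 v20 CUSP2 field
`o[A:A.SG/2]`.  Why it might fail: the dictionary (D1)–(D4) of (24.23)(e); a level where the LP bound is not attained
is fine, a level exceeding it refutes the model.
TYPER FRAMING (appended by the cell typer g14, T-imc-23 v2, 2026-08-28T18:18:21Z; source HOME/imc/Sketch-imc-g18f.lean v2 sha16
542089a401ca956c VERBATIM — its first six decls are the ones already landed above, namespace `…NeronConwayLevel`; MEMO-imc §24
(24.23)–(24.24)): lens imc; E-BLIND single-level cusp LAW = the value-1 vertex of the Katz–Mazur/Edixhoven intersection LP on the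
fine model at `2` (pre-registered PRE-REG 16 before any output).  BC5 witness: ENGINE 6 v20 (kit j314702, 84 levels `4 ∣ N ≤ 352`
interim, evidence on stmt-BirchSwinnertonDyer-22967 n = 58): 84/84, 0 exceptions, NON-VACUOUS at 73; E-141 meanwhile 82/82
(`≤ 640` + 896/960/1024/1152).  NOT in print (nearest: Edixhoven's local equations of `X₀(2^v m)` at `2` [Edixhoven1991] / the
newform statement [CesnaviciusNeururerSaha2023, Thm. 1.5] — shape only).  PAPER STATUS: half-page proof at `v = 3` (MEMO (24.23)(c))
and per-`v` LP certificates to `v = 12`, modulo the dictionary (D1)–(D4) — REF1 R-imc-56 PENDING at filing.  Beyond-print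
theorem: candidate (imc), no in Lean.  OPEN.
[cite: Edixhoven1991, §1 (shape only: local equations / components of `X₀(N)` at `p²`-type levels; the adjacent-cusps half-Conway law is the cell's E-imc-142 — imc MEMO-imc §24 (24.23)–(24.24))] -/
@[conjecture] def TwoAdjacentCuspsHalfConway : Prop :=
  ∀ (N : ℕ) [NeZero N], 8 ∣ N → ∀ x ∈ integralCuspForms0 N 2,
    atkinLehnerInvolutionAt N 2 2 (halfTranslate N 2 x) ∈ integralCuspForms0 N 2 →
      (2 : ℂ) • x ∈ conwayStableLatticeAtTwo N

/-- Edge E-142 ⟹ E-141♭ (imc g18 VERBATIM, PROVED): three-cusp integrality contains integrality at `∞` and `½`. -/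
theorem threeCuspHalfConway_of_twoAdjacent (h : TwoAdjacentCuspsHalfConway) : ThreeCuspHalfConway := by
  intro N _ h8 x hx
  simp only [threeCuspLattice, Submodule.mem_inf, Submodule.mem_comap, LinearMap.coe_comp,
    Function.comp_apply, LinearMap.coe_restrictScalars] at hx
  exact h N h8 x hx.1.1 hx.2

/-- LAW E-imc-143 `EightIntegralAtHalfLevelCusp` (imc g18; conjecture = KM–Edixhoven LP value 3 for every
`v₂(N) = 3…12`): for `8 ∣ N` and ANY integral cusp form `x`, `8·x` is integral at the cusp `1/(N/2)`
(`8 · w(t(w x))` integral): an E-blind universal denominator bound at the fourth reduced component.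
ENGINE 6 v20 EXPS field `ec4 ≤ 3`.
TYPER FRAMING (same source 542089a401ca956c): E-BLIND universal denominator bound; BC5: ENGINE 6 v20 — LP single-cusp bound
`ec4 ≤ 3` with 0 violations at 84/84 levels and ATTAINED at `v = 2, 3` (so `8` is sharp there); NOT in print; REF1 R-imc-56
PENDING.  OPEN.
[cite: Edixhoven1991, §1 (shape only; the universal `8`-integrality at the cusp `1/(N/2)` is the cell's E-imc-143 — imc MEMO-imc §24 (24.24))] -/
@[conjecture] def EightIntegralAtHalfLevelCusp : Prop :=
  ∀ (N : ℕ) [NeZero N], 8 ∣ N → ∀ x ∈ integralCuspForms0 N 2,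
    (8 : ℂ) • atkinLehnerInvolutionAt N 2 2 (halfTranslate N 2 (atkinLehnerInvolutionAt N 2 2 x))
      ∈ integralCuspForms0 N 2

end Summit.BirchSwinnertonDyer.Rank1Residual.ManinAdditive.NeronConwayLevel

end
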